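import Literature.NumberTheory.Sieve.SmoothSumsViaBoxes
import Literature.NumberTheory.Sieve.BalancedRealVectors
import Literature.NumberTheory.Sieve.SmoothBVModuli
import Literature.NumberTheory.Sieve.SmoothPrimePowers
import HarnessLib

/-!
# The small moduli: smooth character sums from a prime number theorem for classes in boxes

Topic `Literature/NumberTheory/Sieve`, sub-namespace `SmoothSmallModuli`. Hinz 1988, p. 178: "If
`1 < N𝔮 ≤ Q₁`, where `Q₁ = (log x)^C` … Mitsui's generalized prime number theorem for arithmetic
progressions [14] enables us to bound the sum under consideration. Since `χ` is a non-principal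
character mod 𝔮, we have `∑_{ω∈ℜ} χ(ω) = ∑_ξ χ(ξ) ∑_{ω≡ξ} 1 = (I/Φ(𝔮)) ∑_ξ χ(ξ) + O(y exp(−c₄√log y))`
`≪ y exp(−c₄√log y)`." This file proves the smooth version of this deduction: GIVEN a uniform
asymptotic for the prime counts `Π(∏(0,y_w]; 𝔮, γ)` in balanced boxes (the statement of Mitsui's
Main Theorem, Hinz (1.6)/p. 178 — taken as an explicit HYPOTHESIS `hPNT` of the theorems, to be
discharged by that published result), the smooth sums `ψ_Ω(χ)` of `SmoothBVCore` are small for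
every non-principal `χ` to a small modulus:

* `primeBoxCount`, `primeBoxCount_mul_unit` — `Π(∏(0,y]; 𝔮, γ) = Π(∏(0,σ(u)y]; 𝔮, uγ)` for a
  totally positive unit `u` (restoring Hinz's shape condition (1.5) by a balancing unit,
  `Balanced.exists_posUnit_mul_le_rpow`);
* `theta`, `norm_theta_le_of_boxBound` — `Θ_{Ω'}(χ) = ∑_{α prime} Ω'(α)χ(α)` through
  `SmoothViaBoxes.norm_sum_prodWeight_le` and orthogonality `∑_γ χ(γ) = 0`;
* `boxBound_of_PNT` — the box bound from the hypothesis `hPNT` after balancing;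
* `psiΩ_eq_theta` — `ψ_Ω(χ) = d log M · Θ_Ω(χ) + ∑_{w₀} Θ_{Ω^{(w₀)}}(χ) + (higher prime powers)`.

## References

* J. Hinz, Acta Arith. 51 (1988), §2 p. 178. [cite: Hinz1988, §2 p. 178]
* T. Mitsui, Jap. J. Math. 26 (1956), Main Theorem. [cite: Mitsui1956, Main Theorem (p. 1; §4 (4.38))]
-/

noncomputable section

open Finset NumberField NumberField.InfinitePlace MeasureTheory Set
  Literature.NumberTheory.Sieve.NumberFieldLS Literature.NumberTheory.Sieve.BoxPrimes
  Literature.NumberTheory.LFunctions Literature.NumberTheory.LFunctions.NumberField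
  Literature.NumberTheory.Sieve.CastilloEtAl2015 Literature.NumberTheory.Sieve.TypeTwoReparam
  Literature.NumberTheory.Sieve.TypeTwoBlock Literature.NumberTheory.Sieve.SmoothCoset
  Literature.NumberTheory.Sieve.SmoothViaBoxes Literature.NumberTheory.Sieve.Balanced
  Literature.NumberTheory.Sieve.SmoothBVCore Literature.NumberTheory.Sieve.SmoothBVModuli
  Literature.NumberTheory.Sieve.SmoothTypeOne Literature.NumberTheory.Sieve.SmoothWeights
  Literature.NumberTheory.LFunctions.AbelianDensity
open scoped Classical

namespace Literature.NumberTheory.Sieve.SmoothSmallModuli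

variable {K : Type*} [Field K] [NumberField K] [IsTotallyReal K]

local notation "d" => Module.finrank ℚ K
local notation "RP" => {w : InfinitePlace K // IsReal w}

/-! ## Prime counts in boxes and balancing units -/

variable (K) in
/-- `Π(∏_w (0, y_w]; 𝔮, γ)`: the prime `ω` with `0 < σ_w ω ≤ y_w` and `ω ≡ γ mod 𝔮`.
[cite: Hinz1988, §1 p. 174 (Π(ℜ; 𝔮, γ))] -/
def primeBoxCount (y : RP → ℝ) (𝔮 : Ideal (𝓞 K)) (γ : 𝓞 K ⧸ 𝔮) : ℕ :=
  ((finite_cbox (K := K) (fun _ => 0) y).toFinset.filter fun ω => Prime ω ∧ Ideal.Quotient.mk 𝔮 ω = γ).card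

/-- **Restoring the shape by a totally positive unit**: `Π(∏(0,y]; 𝔮, γ) = Π(∏(0, σ(u)y]; 𝔮, uγ)`.
[cite: Hinz1988, §1 (1.4)–(1.5)] -/
theorem primeBoxCount_mul_unit (y : RP → ℝ) (𝔮 : Ideal (𝓞 K)) (γ : 𝓞 K ⧸ 𝔮) {u : (𝓞 K)ˣ}
    (hu : NumberField.IsTotPos K ((u : 𝓞 K) : K)) :
    primeBoxCount K y 𝔮 γ =
      primeBoxCount K (fun w => remb K ((u : 𝓞 K) : K) w * y w) 𝔮 (Ideal.Quotient.mk 𝔮 (u : 𝓞 K) * γ) := by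
  unfold primeBoxCount
  have hup : ∀ w : RP, 0 < remb K ((u : 𝓞 K) : K) w := fun w => hu w
  have hassoc : ∀ ω : 𝓞 K, Prime ((u : 𝓞 K) * ω) ↔ Prime ω := fun ω =>
    (associated_unit_mul_left ω (u : 𝓞 K) u.isUnit).prime_iff
  have hcoeK : ∀ ω : 𝓞 K, (((u : 𝓞 K) * ω : 𝓞 K) : K) = ((u : 𝓞 K) : K) * (ω : K) := fun ω => by push_cast; rfl
  refine Finset.card_bij (fun ω _ => (u : 𝓞 K) * ω) (fun ω hω => ?_) (fun ω₁ _ ω₂ _ h => ?_) (fun β hβ => ?_)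
  · rw [Finset.mem_filter, Set.Finite.mem_toFinset, mem_cbox_iff_realEmb] at hω ⊢
    obtain ⟨hbox, hprime, hcl⟩ := hω
    refine ⟨fun w => ?_, (hassoc ω).2 hprime, by rw [map_mul, hcl]⟩
    have h := hbox w
    simp only [Set.mem_Ioc, realEmb_eq_remb] at h ⊢
    rw [hcoeK, remb_mul, Pi.mul_apply]
    exact ⟨mul_pos (hup w) h.1, mul_le_mul_of_nonneg_left h.2 (hup w).le⟩
  · exact mul_left_cancel₀ (Units.ne_zero u) h
  · rw [Finset.mem_filter, Set.Finite.mem_toFinset, mem_cbox_iff_realEmb] at hβ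
    obtain ⟨hbox, hprime, hcl⟩ := hβ
    refine ⟨((u⁻¹ : (𝓞 K)ˣ) : 𝓞 K) * β, ?_, by rw [Units.mul_inv_cancel_left]⟩
    rw [Finset.mem_filter, Set.Finite.mem_toFinset, mem_cbox_iff_realEmb]
    have hβeq : β = (u : 𝓞 K) * (((u⁻¹ : (𝓞 K)ˣ) : 𝓞 K) * β) := by rw [Units.mul_inv_cancel_left]
    refine ⟨fun w => ?_, ?_, ?_⟩
    · have h := hbox w
      simp only [Set.mem_Ioc, realEmb_eq_remb] at h ⊢
      -- `σ_w(u⁻¹β) = σ_w β / σ_w u`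
      have hrel : remb K (β : K) w = remb K ((u : 𝓞 K) : K) w * remb K ((((u⁻¹ : (𝓞 K)ˣ) : 𝓞 K) * β : 𝓞 K) : K) w := by
        conv_lhs => rw [hβeq]
        rw [hcoeK, remb_mul, Pi.mul_apply]
      rw [hrel] at h
      constructor
      · exact pos_of_mul_pos_right h.1 (hup w).le |> fun hp => by
          rcases lt_trichotomy 0 (remb K ((((u⁻¹ : (𝓞 K)ˣ) : 𝓞 K) * β : 𝓞 K) : K) w) with hlt | heq | hgt
          · exact hlt
          · rw [← heq, mul_zero] at h; exact absurd h.1 (lt_irrefl _)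
          · have := mul_neg_of_pos_of_neg (hup w) hgt; linarith [h.1]
      · exact le_of_mul_le_mul_left h.2 (hup w)
    · rw [← hassoc, Units.mul_inv_cancel_left]; exact hprime
    · rw [map_mul, hcl, ← mul_assoc, ← map_mul, Units.inv_mul, map_one, one_mul]

/-! ## `Θ_{Ω'}(χ)` and its bound from a box bound -/

variable (K) in
/-- `Θ_{Ω'}(χ) = ∑_{α ∈ A₀(M), α prime} Ω'(α) χ(α)` for a family profile weight `Ω'`.
[cite: Hinz1988, §2 (2.2)] -/
def theta (kf : RP → ℝ → ℝ) (M : ℝ) {𝔮 : Ideal (𝓞 K)} (χ : AddChar (Additive ((𝓞 K ⧸ 𝔮)ˣ)) ℂ) : ℂ :=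
  ∑ α ∈ (cubeF K M).filter Prime, weightΩfam K kf M α * unitValue χ (Ideal.Quotient.mk 𝔮 α)

/-- On the cube the family weight is the real product of the `gOf` profiles. [folklore] -/
theorem weightΩfam_eq_ofReal_prod (kf : RP → ℝ → ℝ) {M : ℝ} (hM : 0 < M) {α : 𝓞 K} (hα : α ∈ cubeF K M) :
    weightΩfam K kf M α = ((∏ w, gOf (kf w) (remb K (α : K) w / M) : ℝ) : ℂ) := by
  rw [← prodWeight_fam_eq kf hM hα, prodWeight, Complex.ofReal_prod]
  rfl

/-- The box condition on cube points with `s ≤ 1`: `{α ∈ A₀(M) : σ_wα ≤ M s_w} = A₀ ∩ ∏(0, M s_w]`, and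
the prime/class count there is `∑_γ χ(γ) Π(∏(0,Ms]; 𝔮, γ)`. [folklore] -/
theorem sum_filter_box_eq {M : ℝ} (hM : 0 < M) {𝔮 : Ideal (𝓞 K)} [Fintype ((𝓞 K ⧸ 𝔮)ˣ)]
    (χ : AddChar (Additive ((𝓞 K ⧸ 𝔮)ˣ)) ℂ) {s : RP → ℝ} (hs1 : ∀ w, s w ≤ 1) :
    ∑ α ∈ ((cubeF K M).filter Prime).filter (fun α : 𝓞 K => ∀ w, remb K ((α : 𝓞 K) : K) w ≤ M * s w),
        unitValue χ (Ideal.Quotient.mk 𝔮 α) =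
      ∑ γ : (𝓞 K ⧸ 𝔮)ˣ, toMulHom χ γ * (primeBoxCount K (fun w => M * s w) 𝔮 (γ : 𝓞 K ⧸ 𝔮) : ℂ) := by
  -- the index set is the prime part of the box `∏(0, M s]`
  set B := (finite_cbox (K := K) (fun _ => (0 : ℝ)) (fun w => M * s w)).toFinset.filter Prime with hB
  have hset : ((cubeF K M).filter Prime).filter (fun α : 𝓞 K => ∀ w, remb K ((α : 𝓞 K) : K) w ≤ M * s w) = B := by
    ext α
    rw [Finset.mem_filter, Finset.mem_filter, mem_cubeF, mem_box₀_iff_remb, hB, Finset.mem_filter, Set.Finite.mem_toFinset,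
      mem_cbox_iff_realEmb]
    simp only [Set.mem_Ioc, realEmb_eq_remb]
    constructor
    · rintro ⟨⟨hc, hp⟩, hle⟩; exact ⟨fun w => ⟨(hc w).1, hle w⟩, hp⟩
    · rintro ⟨hb, hp⟩
      refine ⟨⟨fun w => ⟨(hb w).1, (hb w).2.trans ?_⟩, hp⟩, fun w => (hb w).2⟩
      have := hs1 w; nlinarith
  rw [hset]
  -- fibrewise over the unit classes: non-unit classes contribute `0`
  unfold primeBoxCount
  have hright : ∀ γ : (𝓞 K ⧸ 𝔮)ˣ, toMulHom χ γ * ((((finite_cbox (K := K) (fun _ => (0 : ℝ)) (fun w => M * s w)).toFinset.filter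
      fun ω => Prime ω ∧ Ideal.Quotient.mk 𝔮 ω = (γ : 𝓞 K ⧸ 𝔮)).card : ℕ) : ℂ) =
      ∑ α ∈ B.filter (fun α => Ideal.Quotient.mk 𝔮 α = (γ : 𝓞 K ⧸ 𝔮)), unitValue χ (Ideal.Quotient.mk 𝔮 α) := by
    intro γ
    have hfil : (finite_cbox (K := K) (fun _ => (0 : ℝ)) (fun w => M * s w)).toFinset.filter
        (fun ω => Prime ω ∧ Ideal.Quotient.mk 𝔮 ω = (γ : 𝓞 K ⧸ 𝔮)) = B.filter (fun α => Ideal.Quotient.mk 𝔮 α = (γ : 𝓞 K ⧸ 𝔮)) := by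
      rw [hB, Finset.filter_filter]
    rw [hfil]
    rw [Finset.sum_congr rfl fun α hα => by rw [(Finset.mem_filter.1 hα).2, unitValue_coe], Finset.sum_const, nsmul_eq_mul, mul_comm]
  rw [Fintype.sum_congr _ _ hright]
  -- `∑_α f(α) = ∑_a ∑_{α : mk α = a} f(α)` since `f = 0` off the unit classes
  simp_rw [Finset.sum_filter]
  rw [Finset.sum_comm]
  refine Finset.sum_congr rfl fun α _ => ?_
  by_cases hunit : IsUnit (Ideal.Quotient.mk 𝔮 α)
  · obtain ⟨u, hu⟩ := hunit
    rw [Finset.sum_eq_single u (fun a _ hne => if_neg (fun h => hne (Units.val_injective (h.symm.trans hu.symm))))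
      (fun h => absurd (Finset.mem_univ u) h), if_pos hu.symm]
  · rw [unitValue_of_not_isUnit χ hunit]
    refine (Finset.sum_eq_zero fun a _ => ?_).symm
    rw [if_neg]
    intro h
    exact hunit (h ▸ a.isUnit)

/-- **`Θ` from a box bound**: if `|∑_γ χ(γ) Π(∏(0,Ms]; 𝔮, γ)| ≤ E` for every `s ∈ (0,1]^d`, and the
profiles `k_w` are smooth and vanish off `(a − log 2, 0)`, then
`|Θ_{Ω'}(χ)| ≤ (∏_w ‖(gOf k_w)'‖₁) E`. [cite: Hinz1988, §2 p. 178] -/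
theorem norm_theta_le_of_boxBound {kf : RP → ℝ → ℝ} {a : ℝ} (hk : ∀ w, ContDiff ℝ (⊤ : ℕ∞) (kf w))
    (hlo : ∀ w v, v ≤ a - Real.log 2 → kf w v = 0) (hhi : ∀ w v, 0 ≤ v → kf w v = 0)
    {M : ℝ} (hM : 0 < M) {𝔮 : Ideal (𝓞 K)} [Fintype ((𝓞 K ⧸ 𝔮)ˣ)] (χ : AddChar (Additive ((𝓞 K ⧸ 𝔮)ˣ)) ℂ)
    {E : ℝ} (hE : ∀ s : RP → ℝ, (∀ w, Real.exp a / 2 ≤ s w ∧ s w ≤ 1) →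
      ‖∑ γ : (𝓞 K ⧸ 𝔮)ˣ, toMulHom χ γ * (primeBoxCount K (fun w => M * s w) 𝔮 (γ : 𝓞 K ⧸ 𝔮) : ℂ)‖ ≤ E) :
    ‖theta K kf M χ‖ ≤ (∏ w, ∫ x, ‖deriv (gOf (kf w)) x‖) * E := by
  have hg : ∀ w, ContDiff ℝ 1 (gOf (kf w)) := fun w => contDiff_gOf (hk w) (hlo w)
  have hgs : ∀ w, HasCompactSupport (gOf (kf w)) := fun w => hasCompactSupport_gOf (hlo w) (hhi w)
  unfold theta
  rw [Finset.sum_congr rfl fun α hα => by rw [weightΩfam_eq_ofReal_prod kf hM (Finset.mem_filter.1 hα).1]]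
  refine norm_sum_prodWeight_le hg hgs hM _ _ fun s hs => ?_
  -- on the support of `∏ (gOf k_w)'`: `e^a/2 ≤ s_w ≤ 1`
  have hs1 : ∀ w, Real.exp a / 2 ≤ s w ∧ s w ≤ 1 := by
    intro w
    have hw : deriv (gOf (kf w)) (s w) ≠ 0 := fun h0 => hs (Finset.prod_eq_zero (Finset.mem_univ w) h0)
    have hmem : s w ∈ tsupport (gOf (kf w)) := by
      by_contra hout
      apply hw
      have := SmoothWeights.iteratedDeriv_eq_zero_of_notMem_tsupport (n := 1) hout
      simpa using this
    have hsub : tsupport (gOf (kf w)) ⊆ Icc (Real.exp a / 2) 1 :=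
      closure_minimal (support_gOf_subset (hlo w) (hhi w)) isClosed_Icc
    exact hsub hmem
  rw [sum_filter_box_eq hM χ fun w => (hs1 w).2]
  exact hE s hs1

omit [NumberField K] [IsTotallyReal K] in
/-- Orthogonality over the unit classes: `∑_γ χ(γ) = 0` for `χ ≠ χ₀`. [folklore] -/
theorem sum_toMulHom_eq_zero {𝔮 : Ideal (𝓞 K)} [Fintype ((𝓞 K ⧸ 𝔮)ˣ)] {χ : AddChar (Additive ((𝓞 K ⧸ 𝔮)ˣ)) ℂ}
    (hχ : χ ≠ 0) : ∑ γ : (𝓞 K ⧸ 𝔮)ˣ, toMulHom χ γ = 0 := by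
  have h := AddChar.sum_eq_zero_iff_ne_zero.2 hχ
  rw [← h]
  exact Fintype.sum_equiv (Additive.ofMul) _ _ fun γ => rfl

omit [NumberField K] [IsTotallyReal K] in
/-- **The box bound from a uniform class asymptotic**: if `Π(∏(0,Ms];𝔮,γ) = T + O(E)` with `T`
independent of `γ`, then `|∑_γ χ(γ) Π(…)| ≤ φ(𝔮) E` for `χ ≠ χ₀`. [cite: Hinz1988, §2 p. 178] -/
theorem norm_sum_char_count_le {𝔮 : Ideal (𝓞 K)} [Fintype ((𝓞 K ⧸ 𝔮)ˣ)] {χ : AddChar (Additive ((𝓞 K ⧸ 𝔮)ˣ)) ℂ}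
    (hχ : χ ≠ 0) {P : (𝓞 K ⧸ 𝔮)ˣ → ℝ} {T E : ℝ} (hP : ∀ γ, |P γ - T| ≤ E) :
    ‖∑ γ : (𝓞 K ⧸ 𝔮)ˣ, toMulHom χ γ * (P γ : ℂ)‖ ≤ Fintype.card ((𝓞 K ⧸ 𝔮)ˣ) * E := by
  have hsplit : ∑ γ : (𝓞 K ⧸ 𝔮)ˣ, toMulHom χ γ * (P γ : ℂ) =
      ∑ γ : (𝓞 K ⧸ 𝔮)ˣ, toMulHom χ γ * ((P γ - T : ℝ) : ℂ) := by
    have h0 := sum_toMulHom_eq_zero hχ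
    have : ∑ γ : (𝓞 K ⧸ 𝔮)ˣ, toMulHom χ γ * ((P γ - T : ℝ) : ℂ) =
        (∑ γ : (𝓞 K ⧸ 𝔮)ˣ, toMulHom χ γ * (P γ : ℂ)) - (∑ γ : (𝓞 K ⧸ 𝔮)ˣ, toMulHom χ γ) * (T : ℂ) := by
      rw [Finset.sum_mul, ← Finset.sum_sub_distrib]
      exact Finset.sum_congr rfl fun γ _ => by push_cast; ring
    rw [this, h0, zero_mul, sub_zero]
  rw [hsplit]
  calc ‖∑ γ : (𝓞 K ⧸ 𝔮)ˣ, toMulHom χ γ * ((P γ - T : ℝ) : ℂ)‖ ≤ ∑ γ : (𝓞 K ⧸ 𝔮)ˣ, ‖toMulHom χ γ * ((P γ - T : ℝ) : ℂ)‖ :=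
        norm_sum_le _ _
    _ ≤ ∑ _γ : (𝓞 K ⧸ 𝔮)ˣ, E := Finset.sum_le_sum fun γ _ => by
        rw [norm_mul, Complex.norm_real, Real.norm_eq_abs]
        have h1 : ‖toMulHom χ γ‖ ≤ 1 := by
          rw [Literature.NumberTheory.LFunctions.AbelianDensity.toMulHom_apply, AddChar.norm_apply]
        calc ‖toMulHom χ γ‖ * |P γ - T| ≤ 1 * |P γ - T| := mul_le_mul_of_nonneg_right h1 (abs_nonneg _)
          _ ≤ E := by rw [one_mul]; exact hP γ
    _ = Fintype.card ((𝓞 K ⧸ 𝔮)ˣ) * E := by rw [Finset.sum_const, Finset.card_univ, nsmul_eq_mul]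

/-! ## The box bound from a prime number theorem for classes in balanced boxes -/

omit [IsTotallyReal K] in
/-- From balanced upper bounds to lower bounds for a positive vector:
`y_w ≤ C v^{1/d}` (`v = ∏ y`, `C > 0`) for all `w` gives `v^{1/d} ≤ C^{d-1} y_w`. [folklore] -/
theorem rpow_le_of_balanced_vec {y : RP → ℝ} (hy : ∀ w, 0 < y w) {C : ℝ}
    (hup : ∀ w, y w ≤ C * (∏ w', y w') ^ ((d : ℝ)⁻¹)) (hcard : Fintype.card RP = d) (w : RP) :
    (∏ w', y w') ^ ((d : ℝ)⁻¹) ≤ C ^ (d - 1) * y w := by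
  have hd : 0 < d := Module.finrank_pos
  set v : ℝ := ∏ w', y w' with hv
  set t : ℝ := v ^ ((d : ℝ)⁻¹) with ht
  have hvpos : 0 < v := Finset.prod_pos fun w' _ => hy w'
  have htpos : 0 < t := Real.rpow_pos_of_pos hvpos _
  have htd : t ^ d = v := by
    rw [ht, ← Real.rpow_natCast, ← Real.rpow_mul hvpos.le, inv_mul_cancel₀ (by exact_mod_cast hd.ne'), Real.rpow_one]
  have hsplit : v = y w * ∏ w' ∈ (Finset.univ : Finset RP).erase w, y w' := by
    rw [hv, Finset.mul_prod_erase _ _ (Finset.mem_univ w)]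
  have hrest : ∏ w' ∈ (Finset.univ : Finset RP).erase w, y w' ≤ (C * t) ^ (d - 1) := by
    calc ∏ w' ∈ (Finset.univ : Finset RP).erase w, y w' ≤ ∏ _w' ∈ (Finset.univ : Finset RP).erase w, (C * t) :=
          Finset.prod_le_prod (fun w' _ => (hy w').le) fun w' _ => hup w'
      _ = (C * t) ^ (d - 1) := by
          rw [Finset.prod_const, Finset.card_erase_of_mem (Finset.mem_univ w), Finset.card_univ, hcard]
  have hle : t ^ d ≤ y w * (C * t) ^ (d - 1) := by
    rw [htd, hsplit]; exact mul_le_mul_of_nonneg_left hrest (hy w).le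
  obtain ⟨m, hm⟩ : ∃ m, d = m + 1 := ⟨d - 1, by omega⟩
  rw [hm, Nat.add_sub_cancel, pow_succ, mul_pow] at hle
  rw [hm, Nat.add_sub_cancel]
  have htm : 0 < t ^ m := pow_pos htpos m
  have : t ^ m * t ≤ t ^ m * (C ^ m * y w) := by nlinarith
  exact le_of_mul_le_mul_left this htm

/-- A totally positive unit has `∏_w σ_w(u) = 1`. [folklore] -/
theorem prod_remb_unit {u : (𝓞 K)ˣ} (hu : NumberField.IsTotPos K ((u : 𝓞 K) : K)) :
    ∏ w : RP, remb K ((u : 𝓞 K) : K) w = 1 := by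
  have h1 := abs_norm_eq_prod_abs_remb (K := K) ((u : 𝓞 K) : K)
  have h2 : (Ideal.absNorm (Ideal.span {(u : 𝓞 K)}) : ℝ) = |(Algebra.norm ℚ ((u : 𝓞 K) : K) : ℝ)| := by
    rw [Ideal.absNorm_span_singleton, ← Algebra.coe_norm_int (u : 𝓞 K), Rat.cast_intCast, Nat.cast_natAbs, Int.cast_abs]
  have h3 : Ideal.span {(u : 𝓞 K)} = ⊤ := Ideal.span_singleton_eq_top.2 u.isUnit
  rw [h3, Ideal.absNorm_top, Nat.cast_one] at h2
  rw [← h2] at h1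
  have h4 : ∏ w : RP, remb K ((u : 𝓞 K) : K) w = ∏ w : RP, |remb K ((u : 𝓞 K) : K) w| :=
    Finset.prod_congr rfl fun w _ => (abs_of_pos (remb_pos_of_isTotPos hu w)).symm
  rw [h4, ← h1]

/-- **The box bound from the prime number theorem for classes in balanced boxes.** Assume (`hPNT`,
the statement of Mitsui's Main Theorem in Hinz's formulation (1.6)/p. 178, for the shape constants
`c₁ = C_b^{1-d}`, `c₂ = C_b` of the balancing constant `C_b`):
`|Π(∏(0,y]; 𝔮, γ) − T(y)/φ(𝔮)| ≤ C v e^{−c√log v}` (`v = ∏ y ≥ x₀`, `N𝔮 ≤ (log v)^A`, `γ` a unit class).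
Then for `M > 0`, `a ≤ 0` with `v₀ = (M e^a/2)^d ≥ max(x₀, 3)` and `N𝔮 ≤ (log v₀)^A`, every
`s ∈ [e^a/2, 1]^d` and every `χ ≠ χ₀ mod 𝔮`:
`|∑_γ χ(γ) Π(∏(0,Ms]; 𝔮, γ)| ≤ φ(𝔮) C M^d e^{−c√log v₀}`. [cite: Hinz1988, §2 p. 178] -/
theorem boxBound_of_PNT {Cb : ℝ} (hCb1 : 1 ≤ Cb)
    (hbal : ∀ s : InfinitePlace K → ℝ, (∀ w, 0 < s w) → ∃ u : (𝓞 K)ˣ, u ∈ posUnits K ∧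
      ∀ w : InfinitePlace K, w ((u : 𝓞 K) : K) * s w ≤ Cb * (∏ w', s w') ^ (1 / (d : ℝ)))
    {T : (RP → ℝ) → ℝ} {A c C x₀ : ℝ} (hc : 0 < c) (hC : 0 ≤ C)
    (hPNT : ∀ y : RP → ℝ, x₀ ≤ ∏ w, y w →
      (∀ w, (Cb ^ (d - 1))⁻¹ * (∏ w', y w') ^ (1 / (d : ℝ)) ≤ y w ∧ y w ≤ Cb * (∏ w', y w') ^ (1 / (d : ℝ))) →
      ∀ 𝔮 : Ideal (𝓞 K), 𝔮 ≠ ⊥ → (Ideal.absNorm 𝔮 : ℝ) ≤ Real.log (∏ w, y w) ^ A →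
      ∀ γ : (𝓞 K ⧸ 𝔮)ˣ, |(primeBoxCount K y 𝔮 (γ : 𝓞 K ⧸ 𝔮) : ℝ) - T y / Nat.card ((𝓞 K ⧸ 𝔮)ˣ)| ≤
        C * (∏ w, y w) * Real.exp (-(c * Real.sqrt (Real.log (∏ w, y w)))))
    {M a : ℝ} (hM : 0 < M) (hA : 0 ≤ A) (hv₀ : x₀ ≤ (M * (Real.exp a / 2)) ^ d) (hv₀3 : 3 ≤ (M * (Real.exp a / 2)) ^ d)
    {𝔮 : Ideal (𝓞 K)} (h𝔮 : 𝔮 ≠ ⊥) [Fintype ((𝓞 K ⧸ 𝔮)ˣ)]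
    (hN𝔮 : (Ideal.absNorm 𝔮 : ℝ) ≤ Real.log ((M * (Real.exp a / 2)) ^ d) ^ A)
    {χ : AddChar (Additive ((𝓞 K ⧸ 𝔮)ˣ)) ℂ} (hχ : χ ≠ 0)
    {s : RP → ℝ} (hs : ∀ w, Real.exp a / 2 ≤ s w ∧ s w ≤ 1) :
    ‖∑ γ : (𝓞 K ⧸ 𝔮)ˣ, toMulHom χ γ * (primeBoxCount K (fun w => M * s w) 𝔮 (γ : 𝓞 K ⧸ 𝔮) : ℂ)‖ ≤
      Fintype.card ((𝓞 K ⧸ 𝔮)ˣ) * (C * M ^ d * Real.exp (-(c * Real.sqrt (Real.log ((M * (Real.exp a / 2)) ^ d))))) := by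
  have hd : 0 < d := Module.finrank_pos
  have hea : 0 < Real.exp a / 2 := by positivity
  have hspos : ∀ w, 0 < s w := fun w => lt_of_lt_of_le hea (hs w).1
  -- the balancing unit for the vector `w ↦ M s_w` (extended to all places = real places)
  set S : InfinitePlace K → ℝ := fun w => M * s ⟨w, IsTotallyReal.isReal w⟩ with hS
  have hSpos : ∀ w, 0 < S w := fun w => mul_pos hM (hspos _)
  obtain ⟨u, hu, hub⟩ := hbal S hSpos
  have hupos : NumberField.IsTotPos K ((u : 𝓞 K) : K) := HeckeCone.mem_posUnits_iff.1 hu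
  -- the balanced box
  set y : RP → ℝ := fun w => remb K ((u : 𝓞 K) : K) w * (M * s w) with hy
  have hypos : ∀ w, 0 < y w := fun w => mul_pos (hupos w) (mul_pos hM (hspos w))
  -- `∏ y = M^d ∏ s =: v`
  have hprod : ∏ w, y w = M ^ d * ∏ w, s w := by
    simp only [hy, Finset.prod_mul_distrib, prod_remb_unit hupos, one_mul, Finset.prod_const, Finset.card_univ, card_RP_eq]
  have hvpos : 0 < ∏ w, y w := Finset.prod_pos fun w _ => hypos w
  -- `v₀ ≤ v ≤ M^d` for `v = ∏ y`
  have hvlo : (M * (Real.exp a / 2)) ^ d ≤ ∏ w, y w := by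
    rw [hprod, mul_pow]
    refine mul_le_mul_of_nonneg_left ?_ (by positivity)
    calc (Real.exp a / 2) ^ d = ∏ _w : RP, (Real.exp a / 2) := by rw [Finset.prod_const, Finset.card_univ, card_RP_eq]
      _ ≤ ∏ w, s w := Finset.prod_le_prod (fun _ _ => hea.le) fun w _ => (hs w).1
  have hvhi : ∏ w, y w ≤ M ^ d := by
    rw [hprod]
    have : ∏ w, s w ≤ 1 := Finset.prod_le_one (fun w _ => (hspos w).le) fun w _ => (hs w).2
    have hMd : 0 ≤ M ^ d := by positivity
    nlinarith
  -- shape condition for `y`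
  have hshape : ∀ w, (Cb ^ (d - 1))⁻¹ * (∏ w', y w') ^ (1 / (d : ℝ)) ≤ y w ∧ y w ≤ Cb * (∏ w', y w') ^ (1 / (d : ℝ)) := by
    have hup : ∀ w : RP, y w ≤ Cb * (∏ w', y w') ^ ((d : ℝ)⁻¹) := by
      intro w
      have h := hub w.1
      have hSy : w.1 ((u : 𝓞 K) : K) * S w.1 = y w := by
        simp only [hS, hy]
        rw [← abs_remb, abs_of_pos (remb_pos_of_isTotPos hupos w)]
      have hSprod : ∏ w' : InfinitePlace K, S w' = ∏ w' : RP, M * s w' := by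
        rw [← Finset.prod_subtype (Finset.univ : Finset (InfinitePlace K)) (p := fun w => IsReal w)
          (fun w => by simp [IsTotallyReal.isReal w]) (fun w => M * s ⟨w, IsTotallyReal.isReal w⟩)]
      rw [hSy, hSprod, one_div] at h
      have hv' : ∏ w', y w' = ∏ w' : RP, M * s w' := by
        rw [hprod, Finset.prod_mul_distrib, Finset.prod_const, Finset.card_univ, card_RP_eq]
      rw [hv']; exact h
    intro w
    refine ⟨?_, by rw [one_div]; exact hup w⟩
    have hlow := rpow_le_of_balanced_vec hypos hup (card_RP_eq (K := K)) w
    rw [one_div, inv_mul_le_iff₀ (by positivity)]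
    linarith [hlow]
  -- apply the PNT to `y` and transport the classes by `u`
  have hPy := hPNT y (hv₀.trans hvlo) hshape 𝔮 h𝔮 (hN𝔮.trans (by
    refine Real.rpow_le_rpow (Real.log_nonneg (by linarith)) (Real.log_le_log (by positivity) hvlo) hA))
  have hP : ∀ γ : (𝓞 K ⧸ 𝔮)ˣ, |(primeBoxCount K (fun w => M * s w) 𝔮 (γ : 𝓞 K ⧸ 𝔮) : ℝ) - T y / Nat.card ((𝓞 K ⧸ 𝔮)ˣ)| ≤
      C * M ^ d * Real.exp (-(c * Real.sqrt (Real.log ((M * (Real.exp a / 2)) ^ d)))) := by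
    intro γ
    -- the class `uγ`
    set γ' : (𝓞 K ⧸ 𝔮)ˣ := (Units.map (Ideal.Quotient.mk 𝔮).toMonoidHom u) * γ with hγ'
    have hcl : Ideal.Quotient.mk 𝔮 (u : 𝓞 K) * (γ : 𝓞 K ⧸ 𝔮) = (γ' : 𝓞 K ⧸ 𝔮) := by
      rw [hγ', Units.val_mul]; rfl
    rw [primeBoxCount_mul_unit (fun w => M * s w) 𝔮 (γ : 𝓞 K ⧸ 𝔮) hupos, hcl]
    refine (hPy γ').trans ?_
    -- `C v e^{-c√log v} ≤ C M^d e^{-c√log v₀}`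
    have h1 : Real.exp (-(c * Real.sqrt (Real.log (∏ w, y w)))) ≤ Real.exp (-(c * Real.sqrt (Real.log ((M * (Real.exp a / 2)) ^ d)))) := by
      refine Real.exp_le_exp.2 (neg_le_neg (mul_le_mul_of_nonneg_left (Real.sqrt_le_sqrt (Real.log_le_log (by linarith) hvlo)) hc.le))
    calc C * (∏ w, y w) * Real.exp (-(c * Real.sqrt (Real.log (∏ w, y w))))
        ≤ C * M ^ d * Real.exp (-(c * Real.sqrt (Real.log (∏ w, y w)))) :=
          mul_le_mul_of_nonneg_right (mul_le_mul_of_nonneg_left hvhi hC) (Real.exp_pos _).le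
      _ ≤ _ := mul_le_mul_of_nonneg_left h1 (by positivity)
  exact norm_sum_char_count_le hχ hP

/-! ## `ψ_Ω(χ)` through the `Θ`'s -/

omit [IsTotallyReal K] in
/-- `Λ((α)) = log N((α))` for a prime element `α`. [folklore] -/
theorem idealVonMangoldt_span_of_prime {α : 𝓞 K} (hα : Prime α) :
    idealVonMangoldt (Ideal.span {α}) = Real.log (Ideal.absNorm (Ideal.span {α}) : ℝ) := by
  have hP : Prime (Ideal.span {α}) := (Ideal.span_singleton_prime hα.ne_zero).2 hα |> Ideal.prime_of_isPrime
    (by rw [Ne, Ideal.span_singleton_eq_bot]; exact hα.ne_zero)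
  have := idealVonMangoldt_prime_pow (R := 𝓞 K) hP one_ne_zero
  rwa [pow_one] at this

/-- **`ψ_Ω(χ) = d log M · Θ_Ω(χ) + ∑_{w₀} Θ_{Ω^{(w₀)}}(χ) + (non-prime part)`.** [cite: Hinz1988, §2 (2.4)] -/
theorem psiΩ_decomp {𝔮 : Ideal (𝓞 K)} (χ : AddChar (Additive ((𝓞 K ⧸ 𝔮)ˣ)) ℂ) (k : ℝ → ℝ) (M : ℝ) :
    psiΩ K χ k M = ((d * Real.log M : ℝ) : ℂ) * theta K (fun _ => k) M χ +
      ∑ w₀ : RP, theta K (twistFam k w₀) M χ +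
      ∑ α ∈ (cubeF K M).filter (fun α => ¬ Prime α),
        weightΩ K (fun v => (k v : ℂ)) M α * unitValue χ (Ideal.Quotient.mk 𝔮 α) * (idealVonMangoldt (Ideal.span {α}) : ℂ) := by
  unfold psiΩ theta
  rw [← Finset.sum_filter_add_sum_filter_not (cubeF K M) Prime]
  congr 1
  -- the prime part
  rw [Finset.mul_sum, Finset.sum_comm, ← Finset.sum_add_distrib]
  refine Finset.sum_congr rfl fun α hα => ?_
  obtain ⟨hαc, hαp⟩ := Finset.mem_filter.1 hα
  have h0 : Ideal.span {α} ≠ ⊥ := by rw [Ne, Ideal.span_singleton_eq_bot]; exact hαp.ne_zero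
  have hlog := weightΩ_mul_log_cofactor (k := k) (M := M) hαc (𝔟 := ⊤) (bot_ne_top (α := Ideal (𝓞 K))).symm
    (⟨Ideal.span {α}, (Ideal.top_mul _).symm⟩ : (⊤ : Ideal (𝓞 K)) ∣ Ideal.span {α})
  rw [NumberFieldVaughan.cofactor_top, Ideal.absNorm_top, Nat.cast_one, Real.log_one, sub_zero] at hlog
  rw [idealVonMangoldt_span_of_prime hαp, mul_right_comm, hlog, add_mul, Finset.sum_mul]
  simp only [weightΩfam_const]
  ring

/-- **The non-prime part is small**: `≤ K_∞^d (d log M) #{α ∈ A₀(M) : Λ((α)) ≠ 0, (α) not prime}`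
(`M ≥ 1`, `|k| ≤ K_∞`). [cite: Hinz1988, §2 (2.4)] -/
theorem norm_nonprime_part_le {k : ℝ → ℝ} {Kmax : ℝ} (hK : ∀ v, |k v| ≤ Kmax) {M : ℝ} (hM : 1 ≤ M)
    {𝔮 : Ideal (𝓞 K)} (h𝔮 : 𝔮 ≠ ⊥) (χ : AddChar (Additive ((𝓞 K ⧸ 𝔮)ˣ)) ℂ) :
    ‖∑ α ∈ (cubeF K M).filter (fun α => ¬ Prime α),
        weightΩ K (fun v => (k v : ℂ)) M α * unitValue χ (Ideal.Quotient.mk 𝔮 α) * (idealVonMangoldt (Ideal.span {α}) : ℂ)‖ ≤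
      Kmax ^ d * (d * Real.log M) *
        ((cubeF K M).filter (fun α => idealVonMangoldt (Ideal.span {α}) ≠ 0 ∧ ¬ (Ideal.span {α}).IsPrime)).card := by
  haveI : Finite (𝓞 K ⧸ 𝔮) := Ideal.finiteQuotientOfFreeOfNeBot 𝔮 h𝔮
  have hKmax : 0 ≤ Kmax := le_trans (abs_nonneg _) (hK 0)
  have hM0 : 0 < M := by linarith
  have hlogM : 0 ≤ Real.log M := Real.log_nonneg hM
  -- drop the terms with `Λ = 0` and bound each remaining term by `K^d · d log M`
  rw [← Finset.sum_filter_ne_zero]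
  have hsub : ((cubeF K M).filter (fun α => ¬ Prime α)).filter
      (fun α => weightΩ K (fun v => (k v : ℂ)) M α * unitValue χ (Ideal.Quotient.mk 𝔮 α) * (idealVonMangoldt (Ideal.span {α}) : ℂ) ≠ 0) ⊆
      (cubeF K M).filter (fun α => idealVonMangoldt (Ideal.span {α}) ≠ 0 ∧ ¬ (Ideal.span {α}).IsPrime) := by
    intro α hα
    rw [Finset.mem_filter, Finset.mem_filter] at hα
    obtain ⟨⟨hc, hnp⟩, hne⟩ := hα
    rw [Finset.mem_filter]
    refine ⟨hc, fun h0 => hne (by rw [h0]; simp), fun hpr => hnp ?_⟩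
    exact (Ideal.span_singleton_prime (MitsuiPNT.ne_zero_of_mem_box₀ (mem_cubeF.1 hc))).1 hpr
  have hterm : ∀ α ∈ (cubeF K M).filter (fun α => idealVonMangoldt (Ideal.span {α}) ≠ 0 ∧ ¬ (Ideal.span {α}).IsPrime),
      ‖weightΩ K (fun v => (k v : ℂ)) M α * unitValue χ (Ideal.Quotient.mk 𝔮 α) * (idealVonMangoldt (Ideal.span {α}) : ℂ)‖ ≤
        Kmax ^ d * (d * Real.log M) := by
    intro α hα
    have hc := (Finset.mem_filter.1 hα).1
    have hα0 : Ideal.span {α} ≠ ⊥ := by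
      rw [Ne, Ideal.span_singleton_eq_bot]; exact MitsuiPNT.ne_zero_of_mem_box₀ (mem_cubeF.1 hc)
    obtain ⟨_, _, hNX⟩ := MitsuiPNT.span_mem_idealFamily (K := K) (mem_cubeF.1 hc)
    have hΛ : idealVonMangoldt (Ideal.span {α}) ≤ d * Real.log M := by
      refine (idealVonMangoldt_le_log hα0).trans ?_
      rw [← Real.log_pow]
      exact Real.log_le_log (TypeTwoCoeff.absNorm_pos_of_ne_bot hα0) hNX
    rw [norm_mul, norm_mul, Complex.norm_real, Real.norm_eq_abs, abs_of_nonneg (idealVonMangoldt_nonneg _)]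
    calc ‖weightΩ K (fun v => (k v : ℂ)) M α‖ * ‖unitValue χ (Ideal.Quotient.mk 𝔮 α)‖ * idealVonMangoldt (Ideal.span {α})
        ≤ Kmax ^ d * 1 * (d * Real.log M) :=
          mul_le_mul (mul_le_mul (norm_weightΩ_le hK M α) (norm_unitValue_le χ _) (norm_nonneg _) (pow_nonneg hKmax _))
            hΛ (idealVonMangoldt_nonneg _) (by positivity)
      _ = Kmax ^ d * (d * Real.log M) := by ring
  calc ‖∑ α ∈ ((cubeF K M).filter (fun α => ¬ Prime α)).filter
          (fun α => weightΩ K (fun v => (k v : ℂ)) M α * unitValue χ (Ideal.Quotient.mk 𝔮 α) * (idealVonMangoldt (Ideal.span {α}) : ℂ) ≠ 0),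
          weightΩ K (fun v => (k v : ℂ)) M α * unitValue χ (Ideal.Quotient.mk 𝔮 α) * (idealVonMangoldt (Ideal.span {α}) : ℂ)‖
      ≤ ∑ α ∈ (cubeF K M).filter (fun α => idealVonMangoldt (Ideal.span {α}) ≠ 0 ∧ ¬ (Ideal.span {α}).IsPrime),
          ‖weightΩ K (fun v => (k v : ℂ)) M α * unitValue χ (Ideal.Quotient.mk 𝔮 α) * (idealVonMangoldt (Ideal.span {α}) : ℂ)‖ :=
        (norm_sum_le _ _).trans (Finset.sum_le_sum_of_subset_of_nonneg hsub fun _ _ _ => norm_nonneg _)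
    _ ≤ ∑ _α ∈ (cubeF K M).filter (fun α => idealVonMangoldt (Ideal.span {α}) ≠ 0 ∧ ¬ (Ideal.span {α}).IsPrime),
          Kmax ^ d * (d * Real.log M) := Finset.sum_le_sum hterm
    _ = _ := by rw [Finset.sum_const, nsmul_eq_mul, mul_comm]

/-- **The small-moduli bound for `ψ_Ω(χ)`**, `χ ≠ χ₀ mod 𝔮`, from the `Θ`-bounds: with
`D_w ≥ ‖(gOf k_w)'‖₁` for the profile and all its place-twists,
`|ψ_Ω(χ)| ≤ (d log M + d) D^d E + K_∞^d (d log M) · #(higher prime powers in A₀(M))`.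
[cite: Hinz1988, §2 p. 178] -/
theorem norm_psiΩ_le_of_theta {k : ℝ → ℝ} {Kmax : ℝ} (hK : ∀ v, |k v| ≤ Kmax) {M : ℝ} (hM : 1 ≤ M)
    {𝔮 : Ideal (𝓞 K)} (h𝔮 : 𝔮 ≠ ⊥) (χ : AddChar (Additive ((𝓞 K ⧸ 𝔮)ˣ)) ℂ) {Dd E : ℝ}
    (hθ0 : ‖theta K (fun _ => k) M χ‖ ≤ Dd * E) (hθ : ∀ w₀ : RP, ‖theta K (twistFam k w₀) M χ‖ ≤ Dd * E) :
    ‖psiΩ K χ k M‖ ≤ (d * Real.log M + d) * (Dd * E) + Kmax ^ d * (d * Real.log M) *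
      ((cubeF K M).filter (fun α => idealVonMangoldt (Ideal.span {α}) ≠ 0 ∧ ¬ (Ideal.span {α}).IsPrime)).card := by
  have hlogM : 0 ≤ Real.log M := Real.log_nonneg hM
  rw [psiΩ_decomp χ k M]
  have h1 : ‖((d * Real.log M : ℝ) : ℂ) * theta K (fun _ => k) M χ‖ ≤ d * Real.log M * (Dd * E) := by
    rw [norm_mul, Complex.norm_real, Real.norm_eq_abs, abs_of_nonneg (by positivity)]
    exact mul_le_mul_of_nonneg_left hθ0 (by positivity)
  have h2 : ‖∑ w₀ : RP, theta K (twistFam k w₀) M χ‖ ≤ d * (Dd * E) := by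
    calc ‖∑ w₀ : RP, theta K (twistFam k w₀) M χ‖ ≤ ∑ w₀ : RP, ‖theta K (twistFam k w₀) M χ‖ := norm_sum_le _ _
      _ ≤ ∑ _w₀ : RP, Dd * E := Finset.sum_le_sum fun w₀ _ => hθ w₀
      _ = d * (Dd * E) := by rw [Finset.sum_const, Finset.card_univ, card_RP_eq, nsmul_eq_mul]
  have h3 := norm_nonprime_part_le hK hM h𝔮 χ
  calc _ ≤ ‖((d * Real.log M : ℝ) : ℂ) * theta K (fun _ => k) M χ + ∑ w₀ : RP, theta K (twistFam k w₀) M χ‖ +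
        ‖∑ α ∈ (cubeF K M).filter (fun α => ¬ Prime α),
          weightΩ K (fun v => (k v : ℂ)) M α * unitValue χ (Ideal.Quotient.mk 𝔮 α) * (idealVonMangoldt (Ideal.span {α}) : ℂ)‖ :=
        norm_add_le _ _
    _ ≤ (d * Real.log M * (Dd * E) + d * (Dd * E)) + Kmax ^ d * (d * Real.log M) *
        ((cubeF K M).filter (fun α => idealVonMangoldt (Ideal.span {α}) ≠ 0 ∧ ¬ (Ideal.span {α}).IsPrime)).card :=
        add_le_add ((norm_add_le _ _).trans (add_le_add h1 h2)) h3
    _ = _ := by ring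

end Literature.NumberTheory.Sieve.SmoothSmallModuli
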